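import Mathlib.Analysis.InnerProductSpace.Adjoint
import Literature.MathematicalPhysics.QuantumFieldTheory.Balaban1983to89.B6SectAOntoV1

/-!
# `Balaban1983to89.B6SectAOperatorsV1` — T. Bałaban, *Propagators and renormalization transformations for lattice gauge
# theories. II*, Commun. Math. Phys. **96** (1984) 223–250 [Balaban1984PropagatorsII], Sect. A pp. 224–226 ON THE V1
# MULTI-LEVEL TORUS CALCULUS: the Hilbert-space data — `L²(T_η)`, vector fields, `L²(𝔅)` as Euclidean spaces and the
# operators `∂, ∂*, Δ = ∂*∂, Q, Q*, Q′, Q′*, a` of (2.7)–(2.20), `N(Q′) = ker Q′`, `ΔN(Q′)`, and **`R`**, *"an orthogonal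
# projection in the space L²(T_η) onto the subspace ΔN(Q′)"* (2.10)–(2.12)

statement-level skeleton of published theorems with citation tags; proofs where landed; nothing here is a claim about the
Yang–Mills mass gap

PDF held: `paper:balaban1984-cmp96-propagators-rt-ii` (journal page = PDF page + 222); pp. 224–228 read AS IMAGES on the ×2
renders `run/shared/lean/pub/pub-balaban/b2b-balaban-ref1/pages/1984-cmp96-propagators-rt-II/…-p002…p006-x2.png` (this seat).

CITATION HEADER (lean-in-tree rule).  Cell `lit-balaban` (HOME `run/shared/lean/pub/lit-balaban/`), PHASE-2 proof seat **p21**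
(gen 5), B6 fold owner r03, referee ref-4; file 4 of 6 of r03's ranked Phase-2 target P2 «B6.Eq2.31 / B6.Eq2.34 as theorems for
the concrete lattice operators (then `B6SectA.critical221_unique` becomes unconditional)» (files: `…B6SectADomainsV1` (domains,
constraints (2.6), gauge group (2.7), Lemmas S/V), `…B6SectAZeroModesV1` (kernel of `Δ_a`), `…B6SectAOntoV1` (`Q`, `Q′` onto), this
file, `…B6SectAVectorModelV1` (`Δ_a` (2.19) positive definite, `G`, `(QGQ*)⁻¹`), `…B6SectACriticalPointV1` ((2.31)/(2.34) concrete,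
*"exactly one critical configuration … given by (2.35)"*)).  WHAT IS REPRODUCED: SKELETON rows B6.Eq2.7/2.8/2.10/2.12/2.14/
2.20 as concrete operators on Euclidean spaces (the data the abstract operator algebra `…B6SectA`/`…B6Eq231`/`…B6Eq218Lagrangian`
quantifies over).  Inputs BY NAME: `LatticeFieldCalculus` (`grad`, `diverg`, `curl`, `laplace`, `sum_grad_mul`, `diverg_grad`),
p27's carriers `…BIJ85AxialPropagator411.BondSpace/PlaqSpace`, file 1's `Domains` (`LamSite`, `LamBond`, `InGauge`), file 3's
`bondAvgIterLin/siteAvgIterLin`; Mathlib's `LinearMap.adjoint` and `Submodule.starProjection`.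

PRINT (pp. 224–226, verbatim).  p. 224: *"λ: A → A^λ = A − ∂λ such that λ = 0 on Λ₀, Q′_jλ = 0 on Λ_j (2.7) … ⟨∂*A − Δλ,
∂*A − Δλ⟩ (2.8)"*; p. 225: *"N(Q′) = {λ: λ satisfies (2.7)}, (2.10) and let R be an orthogonal projection in the space L²(T_η)
onto the subspace ΔN(Q′) … R∂*A = 0 (2.12) … Q′ is here an operator defined on L²(T_η) and with values in the space L²(𝔅) of
functions defined on the set 𝔅 = ⋃_j Λ_j: (Q′λ)(y) = (Q′_jλ)(y) for y ∈ Λ_j, … Of course Q′* is the adjoint operator"*;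
p. 226: *"Δ_a = ∂*∂ + ∂R∂* + Q*aQ (2.19) … (QA)(b) = (Q_jA)(b) for b ∈ Λ_j, (Q₀A)(b) = A(b), a is similarly a multiplication
operator (2.20)"*.

WHAT IS PROVED (0 sorry, 0 new named facts; axioms standard; every nested family `D : Domains P`, lattice factor `c`; ℓ²
pairings — the common volume factor `η^d` of the printed pairings is dropped, which changes no operator identity of Sect. A).
§0 plumbing (`onE`: a linear map of function spaces read on `ℓ²`; `gradFn`, `divFn`, `curlFn`, `diagFn`).  §1 the index sets
`𝔅` (`SiteIdx`, `BondIdx`: `Σ_j Λ_j`, disjoint by construction), the spaces, the operators with their componentwise meaning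
(`dE` = ∂ = `grad`, `dsE` = ∂* = `diverg`, `dcE` = ∂ on vector fields = `curl`, `QE`/`QpE` = the multi-scale `Q`/`Q′`, `aE` = the
weights, `dcsE`/`QsE`/`QpsE` = adjoints), **∂* IS the adjoint of ∂** (`inner_dE_left`, `dsE_eq_adjoint`; `sum_grad_mul`),
`N(Q′) = ker Q′` and `QA = 0` read on functions (`mem_ker_QpE_iff`, `QE_eq_zero_iff`).  §2 `Δ = ∂*∂` (`lapE`, = `laplace`
componentwise), `ΔN(Q′)` (`KE`) and **`R`** (`RE`: symmetric, `R² = R`, maps into `ΔN(Q′)` and fixes it, and (2.12) on test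
functions: `Rv = 0 ↔ ⟨Δμ, v⟩ = 0 ∀ μ ∈ N(Q′)`, i.e. (2.9)).
-/

open scoped InnerProductSpace

namespace Literature.MathematicalPhysics.QuantumFieldTheory.Balaban1983to89.B6SectAOperatorsV1

open LatticeFieldCalculus B6SectADomainsV1 B6SectAOntoV1
open BalabanImbrieJaffe1984to88.BIJ85AxialPropagator411 (BondSpace PlaqSpace)
open BalabanImbrieJaffe1984to88.BIJ85GaugeFunction5113 (grad_add grad_smul)

noncomputable section

variable {P : Params}

/-! ## §0. Plumbing: linear maps of function spaces read on the Euclidean spaces `ℓ²` -/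

section Wrap

variable {ι κ : Type*}

/-- A linear map of function spaces read between the Euclidean spaces `ℓ²(ι) → ℓ²(κ)`. [folklore] -/
def onE (f : (ι → ℝ) →ₗ[ℝ] (κ → ℝ)) : EuclideanSpace ℝ ι →ₗ[ℝ] EuclideanSpace ℝ κ :=
  (WithLp.linearEquiv 2 ℝ (κ → ℝ)).symm.toLinearMap ∘ₗ f ∘ₗ (WithLp.linearEquiv 2 ℝ (ι → ℝ)).toLinearMap

/-- components. [folklore] -/
@[simp] private theorem onE_apply (f : (ι → ℝ) →ₗ[ℝ] (κ → ℝ)) (x : EuclideanSpace ℝ ι) (i : κ) :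
    onE f x i = f (WithLp.ofLp x) i := rfl

/-- the ℓ² pairing `⟨x, y⟩ = Σ_i x_i y_i` (the pairings `⟨·,·⟩` of (2.8)/(2.18) without the volume factor `η^d`). [cite: Balaban1984PropagatorsII, (2.8) p.224] -/
theorem inner_eq_sum [Fintype ι] (x y : EuclideanSpace ℝ ι) : ⟪x, y⟫_ℝ = ∑ i, x i * y i := by
  simp [PiLp.inner_apply, mul_comm]

/-- the diagonal (multiplication) operator with entries `w`. [folklore] -/
def diagFn (w : ι → ℝ) : (ι → ℝ) →ₗ[ℝ] (ι → ℝ) where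
  toFun v i := w i * v i
  map_add' u v := funext fun i => by simp only [Pi.add_apply, mul_add]
  map_smul' r v := funext fun i => by simp only [Pi.smul_apply, smul_eq_mul, RingHom.id_apply]; ring

end Wrap

/-- `∂` on scalar functions (the gradient, lattice factor `c`) as a linear map of function spaces. [cite: Balaban1984PropagatorsI, (1.4) p.18] -/
def gradFn (c : ℝ) : SiteField P 0 ℝ →ₗ[ℝ] VecField P 0 ℝ where
  toFun := grad c
  map_add' := grad_add c
  map_smul' a f := grad_smul c a f

/-- `∂*` on vector fields (the divergence (1.21)) as a linear map of function spaces. [cite: Balaban1984PropagatorsI, (1.21) p.21] -/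
def divFn (c : ℝ) : VecField P 0 ℝ →ₗ[ℝ] SiteField P 0 ℝ where
  toFun := diverg c
  map_add' A B := funext fun x => by
    simp only [diverg, Pi.add_apply, smul_eq_mul, ← Finset.sum_add_distrib]
    exact Finset.sum_congr rfl fun μ _ => by ring
  map_smul' r A := funext fun x => by
    simp only [diverg, Pi.smul_apply, smul_eq_mul, RingHom.id_apply, Finset.mul_sum]
    exact Finset.sum_congr rfl fun μ _ => by ring

/-- `∂` on vector fields (the plaquette variable (1.2)) as a linear map of function spaces. [cite: Balaban1984PropagatorsI, (1.2) p.18] -/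
def curlFn (c : ℝ) : VecField P 0 ℝ →ₗ[ℝ] (Plaq P 0 → ℝ) where
  toFun A p := curl c A p
  map_add' A B := funext fun p => curl_add c A B p
  map_smul' r A := funext fun p => by
    simp only [curl, Pi.smul_apply, smul_eq_mul, RingHom.id_apply]
    ring

/-! ## §1. The carriers and the operators of Sect. A -/

/-- `L²(T_η)` (scalar functions on the fine torus) as a Euclidean space (ℓ² pairing). [cite: Balaban1984PropagatorsII, (2.10) p.225] -/
abbrev ScalarSpace (P : Params) : Type := EuclideanSpace ℝ (Site P 0)

variable (D : Domains P)

/-- `𝔅` for sites: the disjoint union `⋃_{j=0}^k Λ_j` of the site sets (2.3), the index set of the constraints (2.7)/(2.14).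
[cite: Balaban1984PropagatorsII, (2.3)–(2.4) p.224] -/
abbrev SiteIdx : Type := {p : (j : Fin (D.k + 1)) × Site P (j : ℕ) // D.LamSite p.1 p.2}

/-- `𝔅` for bonds: the disjoint union `⋃_{j=0}^k Λ_j` of the bond sets (2.3), the index set of the constraints (2.6)/(2.20).
[cite: Balaban1984PropagatorsII, (2.3) p.224 + (2.20) p.226] -/
abbrev BondIdx : Type := {p : (j : Fin (D.k + 1)) × PBond P (j : ℕ) // D.LamBond p.1 p.2}

/-- `L²(𝔅)` (sites): the target of `Q′`. [cite: Balaban1984PropagatorsII, (2.14)–(2.15) p.225] -/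
abbrev SiteIdxSpace : Type := EuclideanSpace ℝ (SiteIdx D)

/-- `L²(𝔅)` (bonds): the target of `Q`, the space of the data `B` and of the multiplier `ω`. [cite: Balaban1984PropagatorsII, (2.18)–(2.20) p.226] -/
abbrev BondIdxSpace : Type := EuclideanSpace ℝ (BondIdx D)

/-- the multi-scale `Q` of (2.20) on functions: `A ↦ ((Q_jA)(b))_{b ∈ Λ_j, j = 0…k}`. [cite: Balaban1984PropagatorsII, (2.20) p.226] -/
def qFn : VecField P 0 ℝ →ₗ[ℝ] (BondIdx D → ℝ) where
  toFun A i := bondAvgIterLin P ℝ (i.1.1 : ℕ) A i.1.2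
  map_add' A B := funext fun i => by simp only [map_add, Pi.add_apply]
  map_smul' r A := funext fun i => by simp only [map_smul, Pi.smul_apply, RingHom.id_apply]

/-- the multi-scale `Q′` of (2.7)/(2.14) on functions: `λ ↦ ((Q′_jλ)(y))_{y ∈ Λ_j, j = 0…k}`. [cite: Balaban1984PropagatorsII, (2.14) p.225] -/
def qpFn : SiteField P 0 ℝ →ₗ[ℝ] (SiteIdx D → ℝ) where
  toFun f i := siteAvgIterLin P ℝ (i.1.1 : ℕ) f i.1.2
  map_add' f g := funext fun i => by simp only [map_add, Pi.add_apply]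
  map_smul' r f := funext fun i => by simp only [map_smul, Pi.smul_apply, RingHom.id_apply]

/-- **`∂ : L²(T_η) → vector fields`**, `(∂λ)(b) = c(λ(b₊) − λ(b₋))` (the gauge directions `A ↦ A − ∂λ` of (2.7)). [cite: Balaban1984PropagatorsII, (2.7)–(2.8) p.224] -/
def dE (c : ℝ) : ScalarSpace P →ₗ[ℝ] BondSpace P := onE (gradFn c)

/-- **`∂*`** : the divergence `(∂*A)(x) = Σ_μ c(A(x − e_μ, μ) − A(x, μ))` of (2.8) (it IS the adjoint of `∂`: `inner_dE_left`).
[cite: Balaban1984PropagatorsII, (2.8) p.224] -/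
def dsE (c : ℝ) : BondSpace P →ₗ[ℝ] ScalarSpace P := onE (divFn c)

/-- **`∂` on vector fields** (the plaquette variable, the functional (2.5) is `‖∂A‖²`). [cite: Balaban1984PropagatorsII, (2.5) p.224] -/
def dcE (c : ℝ) : BondSpace P →ₗ[ℝ] PlaqSpace P := onE (curlFn c)

/-- **`Q`** of (2.20): `(QA)(b) = (Q_jA)(b)` for `b ∈ Λ_j` (`Q₀ = id`). [cite: Balaban1984PropagatorsII, (2.20) p.226] -/
def QE : BondSpace P →ₗ[ℝ] BondIdxSpace D := onE (qFn D)

/-- **`Q′`** of (2.7)/(2.14): `(Q′λ)(y) = (Q′_jλ)(y)` for `y ∈ Λ_j`. [cite: Balaban1984PropagatorsII, (2.14) p.225] -/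
def QpE : ScalarSpace P →ₗ[ℝ] SiteIdxSpace D := onE (qpFn D)

/-- **`a`**: *"a multiplication operator"* by positive weights on `𝔅` (printed: `a_j(L^jη)^{−2}` on `Λ_j`). [cite: Balaban1984PropagatorsII, (2.18)–(2.20) p.226] -/
def aE (w : BondIdx D → ℝ) : BondIdxSpace D →ₗ[ℝ] BondIdxSpace D := onE (diagFn w)

/-- **`∂*` on plaquette fields**: the adjoint of `∂` on vector fields (the `∂*∂` of (2.19)). [cite: Balaban1984PropagatorsII, (2.19) p.226] -/
def dcsE (c : ℝ) : PlaqSpace P →ₗ[ℝ] BondSpace P := LinearMap.adjoint (dcE (P := P) c)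

/-- **`Q*`**, the adjoint of `Q`. [cite: Balaban1984PropagatorsII, (2.18) p.226] -/
def QsE : BondIdxSpace D →ₗ[ℝ] BondSpace P := LinearMap.adjoint (QE D)

/-- **`Q′*`**, the adjoint of `Q′`. [cite: Balaban1984PropagatorsII, (2.15) p.225] -/
def QpsE : SiteIdxSpace D →ₗ[ℝ] ScalarSpace P := LinearMap.adjoint (QpE D)

/-- `(∂λ)(b) = c(λ(b₊) − λ(b₋))`. [cite: Balaban1984PropagatorsII, (2.7) p.224] -/
@[simp] theorem dE_apply (c : ℝ) (f : ScalarSpace P) (b : PBond P 0) : dE c f b = grad c (WithLp.ofLp f) b := rfl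

/-- `∂λ` as a function. [cite: Balaban1984PropagatorsII, (2.7) p.224] -/
theorem ofLp_dE (c : ℝ) (f : ScalarSpace P) : WithLp.ofLp (dE c f) = grad c (WithLp.ofLp f) := rfl

/-- `(∂*A)(x)` is the divergence. [cite: Balaban1984PropagatorsII, (2.8) p.224] -/
@[simp] theorem dsE_apply (c : ℝ) (x : BondSpace P) (s : Site P 0) : dsE c x s = diverg c (WithLp.ofLp x) s := rfl

/-- `(∂A)(p)` is the plaquette variable. [cite: Balaban1984PropagatorsII, (2.5) p.224] -/
@[simp] theorem dcE_apply (c : ℝ) (x : BondSpace P) (p : Plaq P 0) : dcE c x p = curl c (WithLp.ofLp x) p := rfl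

/-- `(QA)(b) = (Q_jA)(b)`, `b ∈ Λ_j`. [cite: Balaban1984PropagatorsII, (2.20) p.226] -/
@[simp] theorem QE_apply (x : BondSpace P) (i : BondIdx D) :
    QE D x i = bondAvgIter (i.1.1 : ℕ) (WithLp.ofLp x) i.1.2 := rfl

/-- `(Q′λ)(y) = (Q′_jλ)(y)`, `y ∈ Λ_j`. [cite: Balaban1984PropagatorsII, (2.14) p.225] -/
@[simp] theorem QpE_apply (f : ScalarSpace P) (i : SiteIdx D) :
    QpE D f i = siteAvgIter (i.1.1 : ℕ) (WithLp.ofLp f) i.1.2 := rfl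

/-- `(aω)(b) = w(b)ω(b)`. [cite: Balaban1984PropagatorsII, (2.18) p.226] -/
@[simp] theorem aE_apply (w : BondIdx D → ℝ) (ω : BondIdxSpace D) (i : BondIdx D) : aE D w ω i = w i * ω i := rfl

/-- `⟨∂*F, A⟩ = ⟨F, ∂A⟩`. [cite: Balaban1984PropagatorsII, (2.19) p.226] -/
theorem inner_dcsE_left (c : ℝ) (p : PlaqSpace P) (x : BondSpace P) : ⟪dcsE c p, x⟫_ℝ = ⟪p, dcE c x⟫_ℝ :=
  LinearMap.adjoint_inner_left _ _ _

/-- `⟨Q*ω, A⟩ = ⟨ω, QA⟩`. [cite: Balaban1984PropagatorsII, (2.18) p.226] -/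
theorem inner_QsE_left (ω : BondIdxSpace D) (x : BondSpace P) : ⟪QsE D ω, x⟫_ℝ = ⟪ω, QE D x⟫_ℝ :=
  LinearMap.adjoint_inner_left _ _ _

/-- `⟨Q′*ω, λ⟩ = ⟨ω, Q′λ⟩`. [cite: Balaban1984PropagatorsII, (2.15) p.225] -/
theorem inner_QpsE_left (ω : SiteIdxSpace D) (f : ScalarSpace P) : ⟪QpsE D ω, f⟫_ℝ = ⟪ω, QpE D f⟫_ℝ :=
  LinearMap.adjoint_inner_left _ _ _

/-- **`∂*` is the adjoint of `∂`**: `⟨∂λ, A⟩ = ⟨λ, ∂*A⟩` (`LatticeFieldCalculus.sum_grad_mul`). [cite: Balaban1984PropagatorsII, (2.8) p.224] -/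
theorem inner_dE_left (c : ℝ) (f : ScalarSpace P) (x : BondSpace P) : ⟪dE c f, x⟫_ℝ = ⟪f, dsE c x⟫_ℝ := by
  rw [inner_eq_sum, inner_eq_sum]
  exact sum_grad_mul c (WithLp.ofLp f) (WithLp.ofLp x)

/-- `⟨∂*A, λ⟩ = ⟨A, ∂λ⟩`. [cite: Balaban1984PropagatorsII, (2.8) p.224] -/
theorem inner_dsE_left (c : ℝ) (x : BondSpace P) (f : ScalarSpace P) : ⟪dsE c x, f⟫_ℝ = ⟪x, dE c f⟫_ℝ := by
  rw [real_inner_comm, ← inner_dE_left, real_inner_comm]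

/-- `∂* = (∂)†` as operators. [cite: Balaban1984PropagatorsII, (2.8) p.224] -/
theorem dsE_eq_adjoint (c : ℝ) : dsE (P := P) c = LinearMap.adjoint (dE c) :=
  (LinearMap.eq_adjoint_iff _ _).mpr (inner_dsE_left c)

/-- `a` is symmetric. [cite: Balaban1984PropagatorsII, (2.18) p.226] -/
theorem inner_aE_left (w : BondIdx D → ℝ) (ω ω' : BondIdxSpace D) : ⟪aE D w ω, ω'⟫_ℝ = ⟪ω, aE D w ω'⟫_ℝ := by
  rw [inner_eq_sum, inner_eq_sum]
  exact Finset.sum_congr rfl fun i _ => by rw [aE_apply, aE_apply]; ring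

/-- **`N(Q′) = ker Q′`** read on functions: `Q′λ = 0` iff *"λ = 0 on Λ₀, Q′_jλ = 0 on Λ_j"* (2.7), i.e. file 1's `InGauge`.
[cite: Balaban1984PropagatorsII, (2.7) p.224 + (2.10) p.225] -/
theorem mem_ker_QpE_iff (f : ScalarSpace P) : f ∈ LinearMap.ker (QpE D) ↔ D.InGauge (WithLp.ofLp f) := by
  rw [LinearMap.mem_ker]
  constructor
  · intro h j y hy
    have := congrArg (fun g : SiteIdxSpace D => g ⟨⟨⟨j, Nat.lt_succ_of_le (D.le_of_lamSite hy)⟩, y⟩, hy⟩) h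
    simpa using this
  · intro h
    ext i
    rw [QpE_apply, PiLp.zero_apply]
    exact h _ _ i.2

/-- `QA = 0` iff the homogeneous constraints `Q_jA = 0 on Λ_j` hold for all `j` ((2.6) with `B = 0`). [cite: Balaban1984PropagatorsII, (2.6) p.224 + (2.20) p.226] -/
theorem QE_eq_zero_iff (x : BondSpace P) :
    QE D x = 0 ↔ ∀ (j : ℕ) (b : PBond P j), D.LamBond j b → bondAvgIter j (WithLp.ofLp x) b = 0 := by
  constructor
  · intro h j b hb
    have := congrArg (fun g : BondIdxSpace D => g ⟨⟨⟨j, Nat.lt_succ_of_le (D.le_of_lamBond hb)⟩, b⟩, hb⟩) h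
    simpa using this
  · intro h
    ext i
    rw [QE_apply, PiLp.zero_apply]
    exact h _ _ i.2

/-! ## §2. `Δ = ∂*∂`, `ΔN(Q′)` and the orthogonal projection `R` (2.10)–(2.12) -/

/-- **`Δ = ∂*∂`** on `L²(T_η)`. [cite: Balaban1984PropagatorsII, (2.8) p.224] -/
def lapE (c : ℝ) : ScalarSpace P →ₗ[ℝ] ScalarSpace P := dsE c ∘ₗ dE c

/-- `Δ = ∂*∂` is the lattice Laplacian `LatticeFieldCalculus.laplace` (`diverg_grad`). [cite: Balaban1984PropagatorsII, (2.8) p.224] -/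
theorem ofLp_lapE (c : ℝ) (f : ScalarSpace P) : WithLp.ofLp (lapE c f) = laplace c (WithLp.ofLp f) :=
  diverg_grad c (WithLp.ofLp f)

/-- componentwise. [cite: Balaban1984PropagatorsII, (2.8) p.224] -/
theorem lapE_apply (c : ℝ) (f : ScalarSpace P) (s : Site P 0) : lapE c f s = laplace c (WithLp.ofLp f) s :=
  congrFun (ofLp_lapE c f) s

/-- `⟨λ, Δμ⟩ = ⟨∂λ, ∂μ⟩`. [cite: Balaban1984PropagatorsII, (2.8) p.224] -/
theorem inner_lapE_right (c : ℝ) (f g : ScalarSpace P) : ⟪f, lapE c g⟫_ℝ = ⟪dE c f, dE c g⟫_ℝ := by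
  rw [lapE, LinearMap.comp_apply, ← inner_dE_left]

/-- **`ΔN(Q′)`** ⊂ `L²(T_η)`. [cite: Balaban1984PropagatorsII, (2.10) p.225] -/
def KE (c : ℝ) : Submodule ℝ (ScalarSpace P) := (LinearMap.ker (QpE D)).map (lapE c)

/-- **`R`**: *"an orthogonal projection in the space L²(T_η) onto the subspace ΔN(Q′)"*. [cite: Balaban1984PropagatorsII, (2.10)–(2.12) p.225] -/
def RE (c : ℝ) : ScalarSpace P →ₗ[ℝ] ScalarSpace P := ((KE D c).starProjection : ScalarSpace P →L[ℝ] ScalarSpace P)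

/-- unfolding. [cite: Balaban1984PropagatorsII, (2.12) p.225] -/
theorem RE_apply (c : ℝ) (f : ScalarSpace P) : RE D c f = (KE D c).starProjection f := rfl

/-- `R` is symmetric. [cite: Balaban1984PropagatorsII, (2.12) p.225] -/
theorem inner_RE_left (c : ℝ) (u v : ScalarSpace P) : ⟪RE D c u, v⟫_ℝ = ⟪u, RE D c v⟫_ℝ :=
  (KE D c).inner_starProjection_left_eq_right u v

/-- `R` maps into `ΔN(Q′)`. [cite: Balaban1984PropagatorsII, (2.12) p.225] -/
theorem RE_mem (c : ℝ) (f : ScalarSpace P) : RE D c f ∈ KE D c := (KE D c).starProjection_apply_mem f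

/-- `R` fixes `ΔN(Q′)`. [cite: Balaban1984PropagatorsII, (2.12) p.225] -/
theorem RE_eq_self (c : ℝ) {f : ScalarSpace P} (hf : f ∈ KE D c) : RE D c f = f :=
  Submodule.starProjection_eq_self_iff.mpr hf

/-- `R² = R`. [cite: Balaban1984PropagatorsII, (2.12) p.225] -/
theorem RE_comp_RE (c : ℝ) : RE D c ∘ₗ RE D c = RE D c := LinearMap.ext fun f => RE_eq_self D c (RE_mem D c f)

/-- `R` maps into `ΔN(Q′)`, element form: `Rf = Δλ = ∂*∂λ` with `λ ∈ N(Q′)`. [cite: Balaban1984PropagatorsII, (2.10)–(2.12) p.225] -/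
theorem RE_range (c : ℝ) (f : ScalarSpace P) : ∃ n ∈ LinearMap.ker (QpE D), RE D c f = dsE c (dE c n) := by
  obtain ⟨n, hn, h⟩ := Submodule.mem_map.mp (RE_mem D c f)
  exact ⟨n, hn, h.symm⟩

/-- `R(Δλ) = Δλ` for `λ ∈ N(Q′)`. [cite: Balaban1984PropagatorsII, (2.10)–(2.12) p.225] -/
theorem RE_fix (c : ℝ) (n : ScalarSpace P) (hn : n ∈ LinearMap.ker (QpE D)) : RE D c (dsE c (dE c n)) = dsE c (dE c n) :=
  RE_eq_self D c (Submodule.mem_map_of_mem hn)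

/-- **(2.12) read on test functions**: `Rv = 0` iff `v ⊥ ΔN(Q′)`, i.e. `⟨Δμ, v⟩ = 0` for all `μ ∈ N(Q′)` ((2.9)).
[cite: Balaban1984PropagatorsII, (2.9) p.224 + (2.12) p.225] -/
theorem RE_eq_zero_iff (c : ℝ) (v : ScalarSpace P) :
    RE D c v = 0 ↔ ∀ n ∈ LinearMap.ker (QpE D), ⟪lapE c n, v⟫_ℝ = 0 := by
  rw [RE_apply, Submodule.starProjection_apply_eq_zero_iff, Submodule.mem_orthogonal]
  constructor
  · intro h n hn
    exact h _ (Submodule.mem_map_of_mem hn)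
  · rintro h u ⟨n, hn, rfl⟩
    exact h n hn

end

end Literature.MathematicalPhysics.QuantumFieldTheory.Balaban1983to89.B6SectAOperatorsV1
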